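import Summits.ResolutionOfSingularities.ResolutionOfSingularities.Theorems.EquisingularLiftEquisingularLiftLinearCentreKill
import Summits.ResolutionOfSingularities.ResolutionOfSingularities.Theorems.EquisingularLiftEquisingularLiftChainOfHorizChain
import Summits.ResolutionOfSingularities.ResolutionOfSingularities.Theorems.EquisingularLiftEquisingularLiftHorizResolutionBase
import Summits.ResolutionOfSingularities.ResolutionOfSingularities.Theorems.EquisingularLiftEquisingularLiftStrictTransformSpecialFibreTransport
import Summits.ResolutionOfSingularities.ResolutionOfSingularities.Theorems.EquisingularLiftEquisingularLiftCentreBlowupFlatExceptional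
import Literature.AlgebraicGeometry.Resolution.BlowupsExistence
import Literature.AlgebraicGeometry.Resolution.BlowupsRelativeCartier
import HarnessLib

/-!
# `EquisingularLift` (stmt-ResolutionOfSingularities-15660), line `Sketch` v10 — the LINEAR-CENTRE LIFT

[OURS · L1 W4.5b] Helper for the registered stub `stub_EL_of_blowupModel` of the crux `EquisingularLift`; NOT a statement of
any manuscript.

The typing of `EquisingularLift` lets the blow-up centre be ANY regular closed subscheme of the `O`-ambient lying over
non-generic points of `Y`. This file proves the LIFT half of the linear-centre trick: if an integral `H` admits a closed
immersion `j : H → ℙ^{r+m}_k` such that, for the coordinate linear subspace `Λ = V(x_{r+1}, …, x_{r+m})` (the kernel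
ideal sheaf of `Proj` of the graded surjection `k[x_0..x_{r+m}] → k[x_0..x_r]` killing the last `m` variables),
`j(H) ⊄ Λ` and the reduced strict transform of `j(H)` under every blow-up of `ℙ^{r+m}_k` along `Λ` is regular, then the
`∃`-block of `EquisingularLift` holds for `H`: take `O = 𝕎(k)`, `P = ℙ^{r+m}_O`, `Y = g(j(H))` for the closed immersion
`g : ℙ^{r+m}_k → ℙ^{r+m}_O` onto the special fibre, and ONE blow-up along the `O`-linear subspace `Λ_O` (the kernel
ideal sheaf of `Proj` of the same graded surjection over `O`): `V(Λ_O) ≅ ℙ^r_O` is regular and `O`-smooth (hence flat),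
misses a special point, lies off the generic point of `Y`, and `Λ_O · 𝒪_{ℙ_k} = Λ`; the horizontal-chain toolkit
(`stub_chain_of_horizChain` p463069, `flat_exceptional_of_isBlowup_regularCentre_of_smooth` p460210,
`IsBlowup.of_isPullback_of_flat_exceptional`, `closure_preimage_diff_eq_image_pullback` /
`isRegular_subscheme_vanishingIdeal_image_iff` p463675) transports everything to the special fibre.

All statements are def-free: the graded surjections are carried as graded ring homomorphisms `f` with
`f (C a) = C a` and `f (X i) = X ⟨i, _⟩` for `i ≤ r`, `f (X i) = 0` for `i > r`.
-/

set_option linter.dupNamespace false -- mandated namespace `Summit.<Summit>.<Problem>` of this single-conjunct summit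
set_option linter.overlappingInstances false -- signatures carry `[IsDomain O] [IsDiscreteValuationRing O]`

noncomputable section

open CategoryTheory CategoryTheory.Limits AlgebraicGeometry TopologicalSpace
open MvPolynomial HomogeneousLocalization
open Literature.AlgebraicGeometry.Resolution
open AlgebraicGeometry.Scheme.IdealSheafData

attribute [local instance] MvPolynomial.gradedAlgebra
attribute [local instance] Literature.AlgebraicGeometry.Motives.ProjBaseChange.algebraBase

namespace Summit.ResolutionOfSingularities.ResolutionOfSingularities.Cruxes.EquisingularLift.StrataSplit

namespace LinearCentre

/-! ## The structure morphism of the linear subspace `ℙ^r_O → ℙ^{r+m}_O → Spec O` -/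

section StructureMap

variable {O : Type} [CommRing O] {r m : ℕ}


variable (fO : (homogeneousSubmodule (Fin (r + m + 1)) O) →+*ᵍ (homogeneousSubmodule (Fin (r + 1)) O)) (hfO' : HomogeneousIdeal.irrelevant (homogeneousSubmodule (Fin (r + 1)) O) ≤ (HomogeneousIdeal.irrelevant (homogeneousSubmodule (Fin (r + m + 1)) O)).map fO)
  (hfOC : ∀ a : O, fO (C a) = C a)
  (hfOX : ∀ i : Fin (r + m + 1), fO (X i) = if h : (i : ℕ) < r + 1 then X ⟨i, h⟩ else 0)

open Literature.AlgebraicGeometry.Motives.ProjBaseChange in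
include hfOC in
/-- The kill map on homogeneous localizations is compatible with the `O`-algebra structures. [folklore] -/
theorem awayMap_algebraMap_kill (s : MvPolynomial (Fin (r + m + 1)) O) (a : O) :
    Away.map fO s (algebraMap O (Away (homogeneousSubmodule (Fin (r + m + 1)) O) s) a) = algebraMap O (Away (homogeneousSubmodule (Fin (r + 1)) O) (fO s)) a := by
  -- adapted from `ProjectiveAmbientFibre.awayMap_algebraMap` (p160143)
  apply val_injective
  rw [val_algebraMap, algebraMap_eq', Away.map, map_mk, val_mk]
  simp only [SetLike.GradeZero.coe_algebraMap, MvPolynomial.algebraMap_eq]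
  rw [IsScalarTower.algebraMap_apply O (MvPolynomial (Fin (r + 1)) O) (Localization _),
    ← Localization.mk_algebraMap]
  congr 1
  · simp [hfOC, MvPolynomial.algebraMap_eq]
  · ext; simp

include hfOC hfOX in
/-- **`Proj` of the kill map is a morphism over `Spec O`**: `ℙ^r_O → ℙ^{r+m}_O → Spec O` is the structure morphism of
`ℙ^r_O` (checked on the charts `D₊(x_j) = D₊(f_O x_j)`, where both are `Spec` of the `O`-algebra structure map of
`(O[x]_{x_j})₀`). [folklore] -/
theorem projMap_kill_comp_structureMap :
    Proj.map fO hfO' ≫ (Proj.toSpecZero (homogeneousSubmodule (Fin (r + m + 1)) O) ≫ Spec.map (CommRingCat.ofHom (algebraMap O ((homogeneousSubmodule (Fin (r + m + 1)) O) 0)))) =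
      Proj.toSpecZero (homogeneousSubmodule (Fin (r + 1)) O) ≫ Spec.map (CommRingCat.ofHom (algebraMap O ((homogeneousSubmodule (Fin (r + 1)) O) 0))) := by
  have hXO : ∀ i : Fin (r + m + 1), (X i : MvPolynomial (Fin (r + m + 1)) O) ∈ (homogeneousSubmodule (Fin (r + m + 1)) O) 1 := fun i => isHomogeneous_X O i
  have hsec : ∀ j : Fin (r + 1), fO (X (Fin.castLE (le_rm r m) j)) = X j := fun j => by
    rw [← rename_X]
    exact kill_rename fO.toRingHom (fun a => hfOC a) (fun i => hfOX i) (X j)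
  have hspan : (HomogeneousIdeal.irrelevant (homogeneousSubmodule (Fin (r + 1)) O)).toIdeal ≤
      Ideal.span (Set.range fun j : Fin (r + 1) => fO (X (Fin.castLE (le_rm r m) j))) := by
    have hfun : (fun j : Fin (r + 1) => fO (X (Fin.castLE (le_rm r m) j))) = fun j => X j := funext hsec
    rw [hfun]
    exact irrelevant_le_span r O
  let 𝒰 := Proj.affineOpenCoverOfIrrelevantLESpan (homogeneousSubmodule (Fin (r + 1)) O) (fun j : Fin (r + 1) => fO (X (Fin.castLE (le_rm r m) j)))
    (m := fun _ => 1) (fun j => fO.map_mem (hXO _)) (fun _ => one_pos) hspan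
  refine 𝒰.openCover.hom_ext _ _ fun j => ?_
  change Proj.awayι (homogeneousSubmodule (Fin (r + 1)) O) (fO (X (Fin.castLE (le_rm r m) j))) (fO.map_mem (hXO _)) one_pos ≫ _ =
    Proj.awayι (homogeneousSubmodule (Fin (r + 1)) O) (fO (X (Fin.castLE (le_rm r m) j))) (fO.map_mem (hXO _)) one_pos ≫ _
  have hring : (Away.map fO (X (Fin.castLE (le_rm r m) j))).comp
        ((fromZeroRingHom (homogeneousSubmodule (Fin (r + m + 1)) O) _).comp (algebraMap O ((homogeneousSubmodule (Fin (r + m + 1)) O) 0))) =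
      (fromZeroRingHom (homogeneousSubmodule (Fin (r + 1)) O) _).comp (algebraMap O ((homogeneousSubmodule (Fin (r + 1)) O) 0)) := by
    refine RingHom.ext fun a => ?_
    exact awayMap_algebraMap_kill fO hfOC (X (Fin.castLE (le_rm r m) j)) a
  rw [Proj.awayι_comp_map_assoc fO hfO' one_pos (X (Fin.castLE (le_rm r m) j)) (hXO _),
    Proj.awayι_toSpecZero_assoc, Proj.awayι_toSpecZero_assoc, ← Spec.map_comp, ← Spec.map_comp,
    ← Spec.map_comp, ← CommRingCat.ofHom_comp, ← CommRingCat.ofHom_comp, ← CommRingCat.ofHom_comp, hring]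

end StructureMap

/-! ## The linear-centre lift -/

section Main

/-- **THE LINEAR-CENTRE LIFT.** Let `k` be algebraically closed of characteristic `p`, `H` integral, and
`j : H → ℙ^{r+m}_k` a closed immersion; let `f_k : k[x_0..x_{r+m}] → k[x_0..x_r]` be the graded surjection killing
the last `m` variables and `Λ = ker (Proj f_k)` the ideal sheaf of the coordinate linear subspace. If `j(H) ⊄ V(Λ)`
and the reduced strict transform of `j(H)` under every blow-up of `ℙ^{r+m}_k` along `Λ` is regular, then the `∃`-block
of `EquisingularLift` holds for `H` — with `O = 𝕎(k)`, `P = ℙ^{r+m}_O`, ONE blow-up along the `O`-linear subspace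
`ker (Proj f_O)` (regular, `O`-flat, off the generic point of `Y = g(j(H))`), irreducible special fibre.
[OURS · L1 W4.5b] [folklore] -/
theorem EL_of_linearCentre (p : ℕ) (hp : p.Prime) (k : Type) [Field k] [CharP k p] [IsAlgClosed k]
    (H : AlgebraicGeometry.Scheme.{0}) [IsIntegral H] (r m : ℕ)
    (fk : homogeneousSubmodule (Fin (r + m + 1)) k →+*ᵍ homogeneousSubmodule (Fin (r + 1)) k)
    (hfk' : HomogeneousIdeal.irrelevant (homogeneousSubmodule (Fin (r + 1)) k) ≤
      (HomogeneousIdeal.irrelevant (homogeneousSubmodule (Fin (r + m + 1)) k)).map fk)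
    (hfkC : ∀ a : k, fk (C a) = C a)
    (hfkX : ∀ i : Fin (r + m + 1), fk (X i) = if h : (i : ℕ) < r + 1 then X ⟨i, h⟩ else 0)
    (j : H ⟶ Proj (homogeneousSubmodule (Fin (r + m + 1)) k)) [IsClosedImmersion j]
    (hj : ¬ (Set.range j ⊆ ((Proj.map fk hfk').ker.support : Set (Proj (homogeneousSubmodule (Fin (r + m + 1)) k)))))
    (hres : ∀ (W : AlgebraicGeometry.Scheme.{0}) (τ₀ : W ⟶ Proj (homogeneousSubmodule (Fin (r + m + 1)) k)),
      IsBlowup τ₀ (Proj.map fk hfk').ker →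
      Scheme.IsRegular (vanishingIdeal (⟨closure (τ₀ ⁻¹' (Set.range j \
        ((Proj.map fk hfk').ker.support : Set (Proj (homogeneousSubmodule (Fin (r + m + 1)) k))))),
        isClosed_closure⟩ : Closeds W)).subscheme) :
    ∃ (O : Type) (_ : CommRing O) (_ : IsDomain O) (_ : IsDiscreteValuationRing O) (_ : CharZero O)
      (P P' : AlgebraicGeometry.Scheme.{0}) (q : P ⟶ AlgebraicGeometry.Spec (.of O)) (Y : TopologicalSpace.Closeds P)
      (σ : P' ⟶ P) (S' : Set P'), AlgebraicGeometry.Smooth q ∧ AlgebraicGeometry.IsProper q ∧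
      (Y : Set P) ⊆ q ⁻¹' {IsLocalRing.closedPoint O} ∧
      Nonempty ((AlgebraicGeometry.Scheme.IdealSheafData.vanishingIdeal Y).subscheme ≅ H) ∧
      (∀ Q : (∀ X' : AlgebraicGeometry.Scheme.{0}, (X' ⟶ P) → Set X' → Prop),
        Q P (CategoryTheory.CategoryStruct.id P) (Y : Set P) →
        (∀ (X' X'' : AlgebraicGeometry.Scheme.{0}) (σ' : X' ⟶ P) (Y' : Set X') (C : X'.IdealSheafData) (τ : X'' ⟶ X'),
          Q X' σ' Y' → Literature.AlgebraicGeometry.Resolution.IsBlowup τ C →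
          Literature.AlgebraicGeometry.Resolution.Scheme.IsRegular C.subscheme →
          σ' '' (C.support : Set X') ⊆ {x : P | ¬ IsGenericPoint x (Y : Set P)} →
          Q X'' (CategoryTheory.CategoryStruct.comp τ σ') (closure (τ ⁻¹' (Y' \ (C.support : Set X'))))) →
        Q P' σ S') ∧
      IsIrreducible ((CategoryTheory.CategoryStruct.comp σ q) ⁻¹' {IsLocalRing.closedPoint O}) ∧
      Literature.AlgebraicGeometry.Resolution.Scheme.IsRegular
        (AlgebraicGeometry.Scheme.IdealSheafData.vanishingIdeal
          (⟨closure S', isClosed_closure⟩ : TopologicalSpace.Closeds P')).subscheme := by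
  classical
  -- Stage 0: `O = 𝕎(k)`, `P = ℙ^{r+m}_O`, `g : ℙ_k → ℙ_O` the special fibre, `Y = g(j(H))`
  obtain ⟨O, i1, i2, i3, i4, -, -, π, hπ⟩ := stub_wittRing p hp k
  obtain ⟨hsm, hpr⟩ := stub_projectiveAmbientSmoothProper O (r + m)
  obtain ⟨hsmr, -⟩ := stub_projectiveAmbientSmoothProper O r
  haveI := hsm
  let φ : homogeneousSubmodule (Fin (r + m + 1)) O →+*ᵍ homogeneousSubmodule (Fin (r + m + 1)) k :=
    ⟨MvPolynomial.map π, fun h ↦ h.map π⟩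
  have hφ : ∀ q, φ q = MvPolynomial.map π q := fun _ ↦ rfl
  have hφ' := ProjectiveAmbientFibre.irrelevant_le_map_gradedMap π φ hφ
  have hP := ProjectiveAmbientFibre.isPullback_projMap π φ hφ hπ hφ'
  set P : Scheme.{0} := Proj (homogeneousSubmodule (Fin (r + m + 1)) O) with hPdef
  set q : P ⟶ Spec (.of O) := Proj.toSpecZero (homogeneousSubmodule (Fin (r + m + 1)) O) ≫
    Spec.map (CommRingCat.ofHom (algebraMap O (homogeneousSubmodule (Fin (r + m + 1)) O 0))) with hqdef
  set g : Proj (homogeneousSubmodule (Fin (r + m + 1)) k) ⟶ P := Proj.map φ hφ' with hgdef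
  haveI : IsClosedImmersion (Spec.map (CommRingCat.ofHom π)) := IsClosedImmersion.spec_of_surjective _ hπ
  haveI : IsClosedImmersion g := MorphismProperty.IsStableUnderBaseChange.of_isPullback hP.flip inferInstance
  -- adapted from `stub_projectiveAmbientFibre` (p160143): the special fibre is the range of `g`
  have hpt : ∀ x : Spec (.of k), Spec.map (CommRingCat.ofHom π) x = IsLocalRing.closedPoint O := by
    intro x
    rw [Spec.map_apply]
    apply PrimeSpectrum.ext
    rw [PrimeSpectrum.comap_asIdeal, CommRingCat.hom_ofHom, Ideal.eq_bot_of_prime x.asIdeal,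
      ← RingHom.ker_eq_comap_bot]
    exact IsLocalRing.eq_maximalIdeal (RingHom.ker_isMaximal_of_surjective π hπ)
  have hgq : ∀ x, q (g x) = IsLocalRing.closedPoint O := fun x ↦
    (Scheme.Hom.comp_apply g q x).symm.trans
      ((congrArg (fun h : Proj (homogeneousSubmodule (Fin (r + m + 1)) k) ⟶ Spec (.of O) ↦ h x) hP.w).trans
        ((Scheme.Hom.comp_apply _ _ x).trans (hpt _)))
  let f : H ⟶ P := j ≫ g
  let Y : Closeds P := ⟨Set.range f, f.isClosedEmbedding.isClosed_range⟩
  have hYg : (Y : Set P) ⊆ Set.range g := by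
    rintro _ ⟨x, rfl⟩
    exact ⟨j x, (Scheme.Hom.comp_apply _ _ x).symm⟩
  have hYs : (Y : Set P) ⊆ q ⁻¹' {IsLocalRing.closedPoint O} := by
    rintro _ ⟨x, rfl⟩
    change q ((j ≫ g) x) = _
    rw [Scheme.Hom.comp_apply]
    exact hgq _
  have hiso : Nonempty ((vanishingIdeal Y).subscheme ≅ H) := by
    have hYker : vanishingIdeal Y = f.ker := by
      rw [← Scheme.IdealSheafData.map_bot, ← Scheme.nilradical_eq_bot, ← Scheme.IdealSheafData.vanishingIdeal_top,
        Scheme.IdealSheafData.map_vanishingIdeal]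
      congr 1
      ext1
      change Set.range f = closure (f '' Set.univ)
      rw [Set.image_univ, f.isClosedEmbedding.isClosed_range.closure_eq]
    have hker : (vanishingIdeal Y).subschemeι.ker = f.ker := by
      rw [Scheme.IdealSheafData.ker_subschemeι, hYker]
    haveI := IsClosedImmersion.isIso_lift _ f hker
    exact ⟨(asIso (IsClosedImmersion.lift _ f hker.le)).symm⟩
  -- the generic point of `Y` and of `range j`
  have hgenY : IsGenericPoint (f (genericPoint H)) (Y : Set P) := by
    have h := (genericPoint_spec H).image f.continuous
    rwa [Set.image_univ, f.isClosedEmbedding.isClosed_range.closure_eq] at h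
  have hgenj : IsGenericPoint (j (genericPoint H)) (Set.range j) := by
    have h := (genericPoint_spec H).image j.continuous
    rwa [Set.image_univ, j.isClosedEmbedding.isClosed_range.closure_eq] at h
  -- The centre: the `O`-linear subspace `ker (Proj f_O)`
  let f0 : MvPolynomial (Fin (r + m + 1)) O →+* MvPolynomial (Fin (r + 1)) O :=
    (aeval fun i : Fin (r + m + 1) =>
      if h : (i : ℕ) < r + 1 then (X ⟨i, h⟩ : MvPolynomial (Fin (r + 1)) O) else 0).toRingHom
  have hf0C : ∀ a : O, f0 (C a) = C a := fun a => by simp [f0]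
  have hf0X : ∀ i : Fin (r + m + 1), f0 (X i) = if h : (i : ℕ) < r + 1 then X ⟨i, h⟩ else 0 := fun i => by
    simp [f0]
  let fO : homogeneousSubmodule (Fin (r + m + 1)) O →+*ᵍ homogeneousSubmodule (Fin (r + 1)) O :=
    ⟨f0, fun h => isHomogeneous_kill f0 hf0X hf0C h⟩
  have hfOC : ∀ a : O, fO (C a) = C a := hf0C
  have hfOX : ∀ i : Fin (r + m + 1), fO (X i) = if h : (i : ℕ) < r + 1 then X ⟨i, h⟩ else 0 := hf0X
  have hfO' := irrelevant_le_map_kill f0 hf0C hf0X fO (fun _ => rfl)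
  set iO : Proj (homogeneousSubmodule (Fin (r + 1)) O) ⟶ P := Proj.map fO hfO' with hiOdef
  haveI : IsClosedImmersion iO :=
    Literature.AlgebraicGeometry.FundamentalGroup.isClosedImmersion_projMap_of_surjective fO hfO'
      (kill_surjective f0 hf0C hf0X)
  set C : P.IdealSheafData := iO.ker with hCdef
  -- `C · 𝒪_{ℙ_k} = Λ`
  have hKEY : C.comap g = (Proj.map fk hfk').ker :=
    comap_ker_projMap_kill π hπ φ hφ hφ' fO hfO' hfOC hfOX fk hfk' hfkC hfkX
  have hpreC : g ⁻¹' (C.support : Set P) =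
      ((Proj.map fk hfk').ker.support : Set (Proj (homogeneousSubmodule (Fin (r + m + 1)) k))) := by
    have h := Scheme.IdealSheafData.support_comap C g
    rw [hKEY] at h
    rw [h]
    rfl
  have hpreY : g ⁻¹' (Y : Set P) = Set.range j := by
    ext x
    constructor
    · rintro ⟨h, hh⟩
      exact ⟨h, g.isClosedEmbedding.injective ((Scheme.Hom.comp_apply _ _ h).symm.trans hh)⟩
    · rintro ⟨h, rfl⟩
      exact ⟨h, Scheme.Hom.comp_apply _ _ h⟩
  -- regularity of `V(C) ≅ ℙ^r_O`
  have hRr : Scheme.IsRegular (Proj (homogeneousSubmodule (Fin (r + 1)) O)) := fun y =>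
    (stub_goodAtOfSmooth O _ _ hsmr y).1
  have hCreg : Scheme.IsRegular C.subscheme := hRr.of_iso iO.toImage
  -- flatness of `V(C) → Spec O`
  have hflat0 : Flat (C.subschemeι ≫ q) := by
    have h1 : iO.toImage ≫ C.subschemeι ≫ q =
        Proj.toSpecZero (homogeneousSubmodule (Fin (r + 1)) O) ≫
          Spec.map (CommRingCat.ofHom (algebraMap O (homogeneousSubmodule (Fin (r + 1)) O 0))) := by
      rw [← Category.assoc]
      change (iO.toImage ≫ iO.imageι) ≫ q = _
      rw [Scheme.Hom.toImage_imageι]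
      exact projMap_kill_comp_structureMap fO hfO' hfOC hfOX
    haveI := hsmr
    have h2 : Flat (iO.toImage ≫ C.subschemeι ≫ q) := by rw [h1]; infer_instance
    exact (MorphismProperty.cancel_left_of_respectsIso @Flat iO.toImage (C.subschemeι ≫ q)).mp h2
  have hCflat : Flat (C.subschemeι ≫ (𝟙 P ≫ q)) := by
    rw [Category.id_comp]
    exact hflat0
  -- the centre misses a special point and the generic point of `Y`
  have hCx : ∃ x : P, (𝟙 P ≫ q) x = IsLocalRing.closedPoint O ∧ x ∉ (C.support : Set P) := by
    obtain ⟨a, -, haΛ⟩ := Set.not_subset.mp hj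
    refine ⟨g a, ?_, fun hga => haΛ ?_⟩
    · rw [Category.id_comp]
      exact hgq a
    · rw [← hpreC]
      exact hga
  have hCgen : (𝟙 P : P ⟶ P) '' (C.support : Set P) ⊆ {x : P | ¬ IsGenericPoint x (Y : Set P)} := by
    rintro _ ⟨x, hx, rfl⟩ hgx
    change IsGenericPoint x (Y : Set P) at hgx
    have hxe : x = f (genericPoint H) := hgx.eq hgenY
    have hmem : j (genericPoint H) ∈ g ⁻¹' (C.support : Set P) := by
      change g (j (genericPoint H)) ∈ (C.support : Set P)
      rw [← Scheme.Hom.comp_apply, ← hxe]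
      exact hx
    rw [hpreC] at hmem
    apply hj
    rw [← hgenj]
    exact closure_minimal (Set.singleton_subset_iff.mpr hmem) (Proj.map fk hfk').ker.support.isClosed
  -- THE BLOW-UP
  obtain ⟨P', τ, hτ⟩ := exists_isBlowup P C
  have hint := isIntegral_specialFibre_projectiveSpace O (r + m)
  have hH : ∀ Q : (∀ X' : Scheme.{0}, (X' ⟶ P) → Set X' → Prop), Q P (𝟙 P) (Y : Set P) →
      (∀ (X' X'' : Scheme.{0}) (σ' : X' ⟶ P) (Y' : Set X') (C : X'.IdealSheafData) (τ : X'' ⟶ X'),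
        Q X' σ' Y' → IsBlowup τ C → Scheme.IsRegular C.subscheme → Flat (C.subschemeι ≫ (σ' ≫ q)) →
        (∃ x : X', (σ' ≫ q) x = IsLocalRing.closedPoint O ∧ x ∉ (C.support : Set X')) →
        σ' '' (C.support : Set X') ⊆ {x : P | ¬ IsGenericPoint x (Y : Set P)} →
        Q X'' (τ ≫ σ') (closure (τ ⁻¹' (Y' \ (C.support : Set X'))))) →
      Q P' τ (closure (τ ⁻¹' ((Y : Set P) \ (C.support : Set P)))) := by
    intro Q h0 hstep
    have h := hstep P P' (𝟙 P) (Y : Set P) C τ h0 hτ hCreg hCflat hCx hCgen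
    simpa only [Category.comp_id] using h
  obtain ⟨hchain, hirr⟩ := stub_chain_of_horizChain O P P' q Y τ _ hsm hpr hint hH
  -- regularity of the reduced strict transform, transported to the special fibre
  have hexc : Flat ((C.comap τ).subschemeι ≫ τ ≫ q) :=
    flat_exceptional_of_isBlowup_regularCentre_of_smooth O P P' q C hCreg hflat0 τ hτ
  letI : Algebra O k := π.toAlgebra
  have hPB : IsPullback g (Proj.toSpecZero (homogeneousSubmodule (Fin (r + m + 1)) k) ≫
      Spec.map (CommRingCat.ofHom (algebraMap k (homogeneousSubmodule (Fin (r + m + 1)) k 0)))) q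
      (specOfAlgebra O k) := hP
  have hblow : IsBlowup (pullback.snd τ g) (Proj.map fk hfk').ker := by
    rw [← hKEY]
    exact IsBlowup.of_isPullback_of_flat_exceptional k q hτ hPB (IsPullback.of_hasPullback τ g)
  have hdown := hres (pullback τ g) (pullback.snd τ g) hblow
  let T₀ : Closeds ↑(pullback τ g) := ⟨closure ((pullback.snd τ g) ⁻¹' (Set.range j \
    ((Proj.map fk hfk').ker.support : Set (Proj (homogeneousSubmodule (Fin (r + m + 1)) k))))), isClosed_closure⟩
  have hset : closure (τ ⁻¹' ((Y : Set P) \ (C.support : Set P))) = (pullback.fst τ g) '' (T₀ : Set ↑(pullback τ g)) := by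
    rw [closure_preimage_diff_eq_image_pullback τ g (Y : Set P) (C.support : Set P) hYg, hpreY, hpreC]
    rfl
  have hTc : IsClosed ((pullback.fst τ g) '' (T₀ : Set ↑(pullback τ g))) := by
    rw [← hset]
    exact isClosed_closure
  have hreg : Scheme.IsRegular (vanishingIdeal (⟨closure (closure (τ ⁻¹' ((Y : Set P) \ (C.support : Set P)))),
      isClosed_closure⟩ : Closeds P')).subscheme := by
    have hT : (⟨closure (closure (τ ⁻¹' ((Y : Set P) \ (C.support : Set P)))), isClosed_closure⟩ : Closeds P') =
        ⟨(pullback.fst τ g) '' (T₀ : Set ↑(pullback τ g)), hTc⟩ :=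
      Closeds.ext (by
        change closure (closure (τ ⁻¹' ((Y : Set P) \ (C.support : Set P)))) =
          (pullback.fst τ g) '' (T₀ : Set ↑(pullback τ g))
        rw [closure_closure, hset])
    rw [hT]
    exact (isRegular_subscheme_vanishingIdeal_image_iff (pullback.fst τ g) T₀ hTc).mpr hdown
  exact ⟨O, i1, i2, i3, i4, P, P', q, Y, τ, _, hsm, hpr, hYs, hiso, hchain, hirr, hreg⟩

end Main

end LinearCentre

/-- **STUB `stub_linearCentre_lift`** (registered stub of skeleton v10b; LEAD) — the LINEAR-CENTRE LIFT in the registered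
form: for `H` integral and a closed immersion `j : H → ℙ^{r+m}_k`, if `j(H) ⊄ V(Λ)` for the coordinate linear subspace
`Λ = ker (Proj fk)` and the reduced strict transform of `j(H)` under every blow-up along `Λ` is regular, then the `∃`-block
of `EquisingularLift` holds for `H`. Immediate from `LinearCentre.EL_of_linearCentre`. [OURS · L1 W4.5b] [folklore] -/
theorem stub_linearCentre_lift : ∀ p : ℕ, p.Prime → ∀ (k : Type) [Field k] [CharP k p] [IsAlgClosed k] (H : AlgebraicGeometry.Scheme.{0}), AlgebraicGeometry.IsIntegral H → ∀ (r m : ℕ) (fk : MvPolynomial.homogeneousSubmodule (Fin (r + m + 1)) k →+*ᵍ MvPolynomial.homogeneousSubmodule (Fin (r + 1)) k) (hfk' : HomogeneousIdeal.irrelevant (MvPolynomial.homogeneousSubmodule (Fin (r + 1)) k) ≤ (HomogeneousIdeal.irrelevant (MvPolynomial.homogeneousSubmodule (Fin (r + m + 1)) k)).map fk), (∀ a : k, fk (MvPolynomial.C a) = MvPolynomial.C a) → (∀ i : Fin (r + m + 1), fk (MvPolynomial.X i) = if h : (i : ℕ) < r + 1 then MvPolynomial.X ⟨i, h⟩ else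 0) → ∀ (j : H ⟶ AlgebraicGeometry.Proj (MvPolynomial.homogeneousSubmodule (Fin (r + m + 1)) k)), AlgebraicGeometry.IsClosedImmersion j → ¬ (Set.range j ⊆ ((AlgebraicGeometry.Proj.map fk hfk').ker.support : Set (AlgebraicGeometry.Proj (MvPolynomial.homogeneousSubmodule (Fin (r + m + 1)) k)))) → (∀ (W : AlgebraicGeometry.Scheme.{0}) (τ₀ : W ⟶ AlgebraicGeometry.Proj (MvPolynomial.homogeneousSubmodule (Fin (r + m + 1)) k)), Literature.AlgebraicGeometry.Resolution.IsBlowup τ₀ (AlgebraicGeometry.Proj.map fk hfk').ker → Literature.AlgebraicGeometry.Resolution.Scheme.IsRegular (AlgebraicGeometry.Scheme.IdealSheafData.vanishingIdeal (⟨closure (τ₀ ⁻¹' (Set.range j \ ((AlgebraicGeometry.Proj.map fk hfk').ker.support : Set (AlgebraicGeometry.Proj (MvPolynomial.homogeneousSubmodule (Fin (r + m + 1)) k))))), isClosed_closure⟩ : TopologicalSpace.Closeds W)).subscheme) → ∃ (O : Type) (_ : CommRing O) (_ : IsDomain O) (_ : IsDiscreteValuationRing O) (_ : CharZero O) (P P'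 : AlgebraicGeometry.Scheme.{0}) (q : P ⟶ AlgebraicGeometry.Spec (.of O)) (Y : TopologicalSpace.Closeds P) (σ : P' ⟶ P) (S' : Set P'), AlgebraicGeometry.Smooth q ∧ AlgebraicGeometry.IsProper q ∧ (Y : Set P) ⊆ q ⁻¹' {IsLocalRing.closedPoint O} ∧ Nonempty ((AlgebraicGeometry.Scheme.IdealSheafData.vanishingIdeal Y).subscheme ≅ H) ∧ (∀ Q : (∀ X' : AlgebraicGeometry.Scheme.{0}, (X' ⟶ P) → Set X' → Prop), Q P (CategoryTheory.CategoryStruct.id P) (Y : Set P) → (∀ (X' X'' : AlgebraicGeometry.Scheme.{0}) (σ' : X' ⟶ P) (Y' : Set X') (C : X'.IdealSheafData) (τ : X'' ⟶ X'), Q X' σ' Y' → Literature.AlgebraicGeometry.Resolution.IsBlowup τ C → Literature.AlgebraicGeometry.Resolution.Scheme.IsRegular C.subscheme → σ' '' (C.support : Set X') ⊆ {x : P | ¬ IsGenericPoint x (Y : Set P)} → Q X'' (CategoryTheory.CategoryStruct.comp τ σ') (closure (τ ⁻¹' (Y' \ (C.support : Set X'))))) → Q P' σ S') ∧ IsIrreducible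 ((CategoryTheory.CategoryStruct.comp σ q) ⁻¹' {IsLocalRing.closedPoint O}) ∧ Literature.AlgebraicGeometry.Resolution.Scheme.IsRegular (AlgebraicGeometry.Scheme.IdealSheafData.vanishingIdeal (⟨closure S', isClosed_closure⟩ : TopologicalSpace.Closeds P')).subscheme := by
  intro p hp k _ _ _ H hH r m fk hfk' hfkC hfkX j hj hnot hres
  haveI := hH
  haveI := hj
  exact LinearCentre.EL_of_linearCentre p hp k H r m fk hfk' hfkC hfkX j hnot hres

end Summit.ResolutionOfSingularities.ResolutionOfSingularities.Cruxes.EquisingularLift.StrataSplit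

end
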